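/-
Origin: expansion seat `planner-pub-hodgecm-pv06-g5-0`, handover #2 2026-08-18T11:31Z md5 5070603e72fc; rewrites Pv06g5.ArchCompactK->HodgeCM.PerL34.ArchCompactK (x1); tree import HodgeCM.PerL34.BallCRKType; after pv06-g5 #1 (da40467a4fe9); as-landed aslanded/HodgeCM/PerL34/BallStabilizer.lean e4a165538a3a (`HOME/pub-hodgecm-pv06-g5/lean/Pv06g5/BallStabilizer.lean`, md5 5070603e, 100 lines);
landed by the gen-8 packager in gate run 29 as `HodgeCM/PerL34/BallStabilizer.lean` (import ^import Pv06g5\.ArchCompactK[ \t]*$→import HodgeCM.PerL34.ArchCompactK ×1; stripped 3 #print/#check/#eval lines).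
-/
/-
Origin: pub-hodgecm cell, unit pub-hodgecm-pv06-g5 (DAG-NODE PROVER #06, generation 5), 2026-08-18.
Target path in the package: `HodgeCM/PerL34/BallStabilizer.lean`; WIP import `Pv06g5.ArchCompactK` ↦ REWRITE
`import HodgeCM.PerL34.ArchCompactK` (this seat's row #1); `HodgeCM.PerL34.BallCRKType` is a TREE module.

# The stabiliser of the base point of `𝔹²` is the frame-compact piece `U(2,1) ∩ U(3)` (KERNEL junction)

PerL v5 l. 677: "`K_x ≅ U(2) × U(1)` be its stabiliser".  The tree already proves, in the ball model
(`HodgeCM/PerL34/Ball.lean`, pv03: `J = diag(1,1,-1)`, `U21 ≤ GL₃(ℂ)` acting transitively on `𝔹²`, base point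
`x₀ = 0`), that the stabiliser of `x₀` consists of the block-diagonal matrices: `BallCR.stab_iff`,
`BallCR.stab_upper`, `BallCR.stab_lower` (pv02-g3, `BallCRKType.lean`) and `P43KTypesU2.stab_iff_mem_range`
(`K = U(2) × U(1) ≅ Stab(x₀)`).  This short file adds ONLY the junction with the archimedean compact piece of
`HodgeCM/PerL34/ArchCompactK.lean` (§2):

* `mul_J_eq_J_mul_iff`                  : a `3 × 3` matrix commutes with `J` iff it is block-diagonal `(2) ⊕ (1)`;
* `smul_x₀_eq_self_iff_commute`         : `g • x₀ = x₀ ↔ g J = J g`;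
* `mem_stabilizer_x₀_iff_mem_frameSet`  : **`Stab_{U(2,1)}(x₀) = U(2,1) ∩ frameSet J 1`**, the frame-compact piece in
  the frame `T = 1`; equivalently `smul_x₀_eq_self_iff_unitary : g • x₀ = x₀ ↔ gᴴ g = 1`.

So, through a Sylvester frame `T` of `H^{w₁}` (`HermSpace3.exists_frame_place`), PerL's `K_∞` of `ArchCompactK` §4
is, at the place `w₁`, the `T`-conjugate of the stabiliser of the base point of `𝔹²` (times `∏_{w ≠ w₁} U(3)`):
`G_U(ℝ)/K_∞ = 𝔹² × pt` at the level of points.  Fully proved, standard axioms (`#print axioms` below).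
-/
import Summits.HodgeConjecture.HodgeCM.PerL34.BallCRKType
import Summits.HodgeConjecture.HodgeCM.PerL34.ArchCompactK_2

/-! PORT of `HodgeCM/PerL34/BallStabilizer.lean` (HodgeCMPerL run 82) — verbatim mechanical port; provenance in the PORT header line. -/

set_option autoImplicit false

noncomputable section

open scoped Matrix

namespace HodgeCM.PerL34.BallStabilizer

open HodgeCM.PerL34.BallModel

/-- A `3 × 3` matrix commutes with `J = diag(1,1,-1)` iff it is block-diagonal `(2) ⊕ (1)`. -/
theorem mul_J_eq_J_mul_iff (g : Matrix (Fin 3) (Fin 3) ℂ) :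
    g * J = J * g ↔ g 0 2 = 0 ∧ g 1 2 = 0 ∧ g 2 0 = 0 ∧ g 2 1 = 0 := by
  constructor
  · intro h
    have e := fun i j => congrFun (congrFun h i) j
    have e02 := e 0 2
    have e12 := e 1 2
    have e20 := e 2 0
    have e21 := e 2 1
    simp only [J, Matrix.mul_diagonal, Matrix.diagonal_mul, Matrix.cons_val_zero, Matrix.cons_val_one, Matrix.cons_val_two,
      Matrix.head_cons, Matrix.tail_cons, Nat.succ_eq_add_one, Nat.reduceAdd, Fin.isValue, mul_one, one_mul,
      mul_neg, neg_mul] at e02 e12 e20 e21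
    refine ⟨?_, ?_, ?_, ?_⟩
    · linear_combination (-(1 : ℂ) / 2) * e02
    · linear_combination (-(1 : ℂ) / 2) * e12
    · linear_combination ((1 : ℂ) / 2) * e20
    · linear_combination ((1 : ℂ) / 2) * e21
  · rintro ⟨h02, h12, h20, h21⟩
    ext i j
    fin_cases i <;> fin_cases j <;>
      simp [J, Matrix.mul_diagonal, Matrix.diagonal_mul, h02, h12, h20, h21]

/-- **`Stab_{U(2,1)}(x₀)` = the matrices of `U(2,1)` commuting with `J`** (block-diagonal `U(2) × U(1)`,
PerL l. 677); assembled from the tree's `BallCR.stab_iff` / `BallCR.stab_lower`. -/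
theorem smul_x₀_eq_self_iff_commute (g : U21) : g • x₀ = x₀ ↔ mat g * J = J * mat g := by
  rw [mul_J_eq_J_mul_iff]
  constructor
  · intro h
    exact ⟨BallCR.stab_upper h 0, BallCR.stab_upper h 1, BallCR.stab_lower h 0, BallCR.stab_lower h 1⟩
  · rintro ⟨h0, h1, -, -⟩
    rw [BallCR.stab_iff]
    intro i
    fin_cases i
    · exact h0
    · exact h1

/-- **The stabiliser of the base point is the frame-compact piece** `U(2,1) ∩ U(3)` of
`HodgeCM.PerL34.ArchCompactK` (§2, frame `T = 1`). -/
theorem mem_stabilizer_x₀_iff_mem_frameSet (g : U21) :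
    g ∈ MulAction.stabilizer U21 x₀ ↔ mat g ∈ ArchCompactK.frameSet J 1 := by
  rw [MulAction.mem_stabilizer_iff, smul_x₀_eq_self_iff_commute,
    ArchCompactK.mem_frameSet_iff_commute (H := J) (T := 1) (by simp) BallFrame.J_mul_J]
  simp only [inv_one, Units.val_one, Matrix.one_mul, Matrix.mul_one]
  exact (and_iff_right (mat_mem g)).symm

/-- Equivalently: for `g ∈ U(2,1)`, `g • x₀ = x₀ ↔ gᴴ g = 1`. -/
theorem smul_x₀_eq_self_iff_unitary (g : U21) : g • x₀ = x₀ ↔ (mat g)ᴴ * mat g = 1 := by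
  rw [← MulAction.mem_stabilizer_iff, mem_stabilizer_x₀_iff_mem_frameSet, ArchCompactK.mem_frameSet_iff]
  simp only [inv_one, Units.val_one, Matrix.one_mul, Matrix.mul_one]
  exact and_iff_right (mat_mem g)

/-- Hence the stabiliser is the trace on `U(2,1)` of a COMPACT set of matrices (`ArchCompactK.isCompact_frameSet`). -/
theorem stabilizer_x₀_eq_preimage_frameSet :
    (MulAction.stabilizer U21 x₀ : Set U21) = mat ⁻¹' ArchCompactK.frameSet J 1 :=
  Set.ext fun g => mem_stabilizer_x₀_iff_mem_frameSet g

end HodgeCM.PerL34.BallStabilizer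

end

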